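import Summits.QuantumFields.BalabanUV.Beta.GAN24.S3RowV0
import Summits.QuantumFields.BalabanUV.Beta.GAN24.RowV0TableAt
import Summits.QuantumFields.BalabanUV.Beta.GAN24.E3UnitSplitLevelsVAt

/-!
# `BalabanUV.Beta.GAN24.S3RowV0At` — binder row G-an2-4 / (CONV-C), road S3 AT THE IN-BLOCK ROOT, V half: package (ρV-c), part 2, of «ROOTED-S3-V»
# (OWNER gan24-p1-g21 (W11) «GO NOW, WANTED»; `gen21/BORNV-PLAN-v0.md` §3) — **ROAD S3's BIRTH-0 V ROW (`S3RowV0.shapeV0`) RE-RUN FOR an1's ROOTED (V-H)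
# TABLE `vhSAt (toSite r) 3 Lc`** ⇒ END **`shapeV0_at`**: `∃ c₀V δ, 0 ≤ c₀V ∧ 0 < δ ∧ ∀ r ∈ box (3+1) Lc, ∀ n, LocStencil (N^{2(d+1)}·e3OfS N (((Lc^4)^(n+1)·cVH) •
# pushSum Lc (Lc^(n+1)) (mfNeg (vhSAt (toSite r) 3 Lc κ u)))) (c₀V·(Lc⁻¹)^(n+1)) δ` — the SAME constants as the base row, constants BEFORE the root.

NOT IN PRINT; OUR BOOKKEEPING (unit `b2b-balaban-gan24-p2`, gen 33 = prover-b2b-balaban-gan24-p2-g33-0, road-P2 chair of row G-an2-4; CRUX TEAM (2), 2026-08-21; the owner's gen-6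
`mkroot.py` METHOD: the base proof VERBATIM with `vhS 3 Lc ↦ vhSAt (toSite r) 3 Lc`, one extra binder `(hr : r ∈ box (3+1) Lc)`, MY `RowV0TableAt.table_suppR_*` ∕ `table_mass2_*`
and `E3UnitSplitLevelsVAt.e3VH0_unit_split_at` in place of the base table facts ∕ template; everything else BY NAME; base modules untouched).  [folklore]; 0 `def`, 0 cited
facts, 0 `def … : Prop`, 0 sorry; NO new estimate of Bałaban's.  HONEST FRAMING (cell contract, verbatim): «discharging `BetaPertH` makes Bałaban's UV stability
UNCONDITIONAL — a real constructive-QFT result; it is NOT the continuum limit and NOT the Clay problem.»  HONEST DEPENDENCY (verbatim): «continuum YM on T⁴ ⇐ BetaPertH ∧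
nine spine estimates (0/9 proved); BetaPertH ⇐ (D1) ∧ (D4) ∧ CAP+tail; G-an2-4 gates asym, D1 and NE2/3/4.»  Discharges NOTHING of (hS, hSall) ∕ hB by itself (an INPUT of the
V half's (V-U) `BornBorderUndressedRow`); NEVER «G-an2-4 closed»; NOT D1, NOT BetaPertH, NOT continuum, NOT Clay.
-/

noncomputable section

open Finset
open scoped BigOperators
open Literature.MathematicalPhysics.QuantumFieldTheory
open Literature.MathematicalPhysics.QuantumFieldTheory.Balaban1983to89
open Literature.MathematicalPhysics.QuantumFieldTheory.Balaban1983to89.Beta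
open B12Sec2to5 (l1 l1_nonneg)
open ExpKernelCalculus (MKer Zl Zl_nonneg l1_sub_symm)
open LatticeForm (quo)
open KernelSpecInstance (wH)
open KKTFluctuationKernel (GamΦ)
open OneStepResolventKernel (Fib LocStencil KInv)
open StepJetData (mfNeg)
open AffineAveraging (box toSite)
open AveragingHessianKernels (ell)
open AveragingHessianKernelsRooted (vhSAt)
open BalabanCompositeJets (pushSum)
open Summit.QuantumFields.BalabanUV.Beta.GAN24.E3UnitSplit (e3OfS e3OfS_inl_inr e3OfS_inr)
open Summit.QuantumFields.BalabanUV.Beta.GAN24.E3UnitSplitLevelsVAt (e3VH0_unit_split_at)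
open Summit.QuantumFields.BalabanUV.Beta.GAN24.TaylorVHSandwich (abs_twoChannel_le)
open Summit.QuantumFields.BalabanUV.Beta.GAN24.StencilSlotE3PhiLeg (phiLeg_three)
open Summit.QuantumFields.BalabanUV.Beta.GAN24.StencilSlotE3HLeg (legs_three)
open Summit.QuantumFields.BalabanUV.Beta.GAN24.RowV0TableAt (table_suppR_mf table_suppR_fm table_mass2_mf table_mass2_fm)
open Summit.QuantumFields.BalabanUV.Beta.GAN24.S3RowV0 (leg_mono)

namespace Summit.QuantumFields.BalabanUV.Beta.GAN24.S3RowV0At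

variable {Lc : ℕ} [NeZero Lc]

/-! ## §1 One constant and one rate for all legs -/

/-! ## §2 ROW V0 -/

/-- **SHAPE ROW S3-V0 AT THE IN-BLOCK ROOT, UNCONDITIONAL** (`d = 3`, `Lc ≥ 1`; constants BEFORE the root): for every `r ∈ box (3+1) Lc` and every `n`, the
level-0 ROOTED (V-H) piece `mfNeg (vhSAt (toSite r) 3 Lc κ u)` pushed `n+1` times, read by the normalised third-jet functional of member `n+2`, is a local stencil
family with constant `c₀V·(Lc⁻¹)^{n+1}` — the base `S3RowV0.shapeV0` with `vhS ↦ vhSAt (toSite r)`, the SAME `c₀V`, `δ`.  Engines BY NAME: MY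
`E3UnitSplitLevelsVAt.e3VH0_unit_split_at`, `TaylorVHSandwich.abs_twoChannel_le`, `StencilSlotE3PhiLeg.phiLeg_three`, `StencilSlotE3HLeg.legs_three`, MY `RowV0TableAt`,
the base's `leg_mono`. [folklore] -/
theorem shapeV0_at (hL : 1 ≤ Lc) (cVH : ℝ) :
    ∃ c₀V δ : ℝ, 0 ≤ c₀V ∧ 0 < δ ∧ ∀ (r : Fin (3 + 1) → ℕ), r ∈ box (3 + 1) Lc → ∀ n : ℕ,
      LocStencil (fun κ' u' x' z' a b => ((Lc : ℝ) ^ (n + 1 + 1)) ^ (2 * (3 + 1)) *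
        e3OfS (Lc ^ (n + 1 + 1)) (fun κ u => ((((Lc : ℝ) ^ (3 + 1)) ^ (n + 1)) * cVH) • pushSum Lc (Lc ^ (n + 1)) (mfNeg (vhSAt (toSite r) 3 Lc rfl κ u)))
          κ' u' x' z' a b) (c₀V * ((Lc : ℝ)⁻¹) ^ (n + 1)) δ := by
  -- legs: one constant `A`, one rate `κ₁`
  obtain ⟨CΦ, δΦ, hδΦ, hCΦ, hΦrow, hΦcol⟩ := phiLeg_three (Lc := Lc)
  obtain ⟨CH, κH, hκH, hCH, hHleg, hGleg⟩ := legs_three (Lc := Lc)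
  set A : ℝ := max CΦ CH with hA
  have hA0 : 0 ≤ A := hCΦ.trans (le_max_left _ _)
  set κ₁ : ℝ := min δΦ κH with hκ₁
  have hκ₁pos : 0 < κ₁ := lt_min hδΦ hκH
  have hL0 : (0 : ℝ) < Lc := by exact_mod_cast (show 0 < Lc by omega)
  -- the n-free table mass unit and the sandwich constant
  set B₂ : ℝ := (((2 * (2 * (3 + 1) * Lc) + 1 : ℕ) : ℝ) ^ (3 + 1) *
      (((2 * (2 * (3 + 1) * Lc) + 1 : ℕ) : ℝ) ^ (3 + 1) * (3 * (ell (3 + 1) Lc : ℝ) ^ 2))) with hB₂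
  have hB₂0 : 0 ≤ B₂ := by positivity
  have hZ : 0 ≤ Zl (3 + 1) (κ₁ / 2) := Zl_nonneg (by positivity)
  set K : ℝ := 2 * ((Fintype.card (Fin (3 + 1)) : ℝ) ^ 3 * A ^ 3 * Real.exp (κ₁ * (4 * (3 + 1) * (8 * (3 + 1)) + 2 * (3 + 1))) * B₂ *
      Zl (3 + 1) (κ₁ / 2)) with hK
  have hK0 : 0 ≤ K := by positivity
  set c₀V : ℝ := |cVH| / (Lc : ℝ) ^ (3 + 1) * ((Lc : ℝ) ^ 2)⁻¹ * K with hc₀V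
  have hc₀V0 : 0 ≤ c₀V := by positivity
  refine ⟨c₀V, κ₁ / 2, hc₀V0, by positivity, fun r hr n => ?_⟩
  intro κ' u' x' z' a b
  dsimp only
  have hRHS : 0 ≤ c₀V * ((Lc : ℝ)⁻¹) ^ (n + 1) * Real.exp (-(κ₁ / 2) * (l1 (x' - u') + l1 (z' - u'))) := by positivity
  rcases a with α | μ
  · rcases b with β | ν
    · -- the field–field block: the two-channel template
      rw [e3VH0_unit_split_at (Lc := Lc) (d := 3) (toSite r) cVH (n + 1) (n + 1 + 1) rfl κ' u' x' z' α β]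
      have ecast : (((Lc ^ (n + 1 + 1) : ℕ) : ℝ)) = (Lc : ℝ) ^ (n + 1 + 1) := by push_cast; ring
      have hmP : 0 ≤ (Lc : ℝ) ^ (n + 1) * B₂ := mul_nonneg (pow_nonneg hL0.le _) hB₂0
      haveI : NeZero (Lc ^ (n + 1 + 1)) := ⟨pow_ne_zero _ (NeZero.ne Lc)⟩
      have h2 := abs_twoChannel_le (N := Lc ^ (n + 1 + 1)) (ι := Fin (3 + 1))
        (fun w l => ((Lc : ℝ) ^ (n + 1 + 1)) ^ (2 * (3 + 1)) *
          KInv (N := Lc ^ (n + 1 + 1)) (d := 3) (((Lc ^ (n + 1 + 1) : ℕ) : ℤ) • x') w (Sum.inr α) (Sum.inr l))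
        (fun w l => ((Lc : ℝ) ^ (n + 1 + 1)) ^ (3 + 2) * GamΦ (N := Lc ^ (n + 1 + 1)) α x' l w)
        (fun k u => ((Lc : ℝ) ^ (n + 1 + 1)) ^ (3 + 2) * wH (N := Lc ^ (n + 1 + 1)) k κ' (u - ((Lc ^ (n + 1 + 1) : ℕ) : ℤ) • u'))
        (fun y l' => ((Lc : ℝ) ^ (n + 1 + 1)) ^ (3 + 2) * wH (N := Lc ^ (n + 1 + 1)) l' β (y - ((Lc ^ (n + 1 + 1) : ℕ) : ℤ) • z'))
        (fun y l' => ((Lc : ℝ) ^ (n + 1 + 1)) ^ (2 * (3 + 1)) *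
          KInv (N := Lc ^ (n + 1 + 1)) (d := 3) y (((Lc ^ (n + 1 + 1) : ℕ) : ℤ) • z') (Sum.inr l') (Sum.inr β))
        (fun k u w y l l' => pushSum Lc (Lc ^ (n + 1)) (mfNeg (vhSAt (toSite r) 3 Lc rfl k u)) w y (Sum.inr l) (Sum.inl l'))
        (fun k u w y l l' => pushSum Lc (Lc ^ (n + 1)) (mfNeg (vhSAt (toSite r) 3 Lc rfl k u)) w y (Sum.inl l) (Sum.inr l'))
        (x' := x') (u' := u') (z' := z') (A := A) (κ := κ₁) (mP := (Lc : ℝ) ^ (n + 1) * B₂) (R := 8 * (3 + 1) * Lc ^ (n + 1 + 1))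
        hκ₁pos hA0 hmP
        (fun w l => leg_mono (hΦrow (n + 1) x' w α l) (le_max_left _ _) (min_le_left _ _) (l1_nonneg _) hCΦ)
        (fun w l => by
          have h := hGleg (n + 1) α l x' w
          rw [l1_sub_symm] at h
          exact leg_mono h (le_max_right _ _) (min_le_right _ _) (l1_nonneg _) hCH)
        (fun k u => leg_mono (hHleg (n + 1) k κ' u u') (le_max_right _ _) (min_le_right _ _) (l1_nonneg _) hCH)
        (fun y l' => leg_mono (hHleg (n + 1) l' β y z') (le_max_right _ _) (min_le_right _ _) (l1_nonneg _) hCH)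
        (fun y l' => leg_mono (hΦcol (n + 1) y z' l' β) (le_max_left _ _) (min_le_left _ _) (l1_nonneg _) hCΦ)
        (fun k u w y l l' h => table_suppR_mf hL hr (n + 1) k u w y l l' h)
        (fun k u w y l l' h => table_suppR_fm hL hr (n + 1) k u w y l l' h)
        (fun k u l l' S T => table_mass2_mf hL hr (n + 1) k u l l' S T)
        (fun k u l l' S T => table_mass2_fm hL hr (n + 1) k u l l' S T)
      rw [ecast] at h2
      -- the prefactor
      have hLp : (0 : ℝ) < ((Lc : ℝ) ^ (n + 1 + 1)) ^ 2 := by positivity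
      have hpre : |-(cVH / (Lc : ℝ) ^ (3 + 1)) * ((Lc : ℝ) ^ (n + 1 + 1)) ^ (-(2 : ℤ))| =
          |cVH| / (Lc : ℝ) ^ (3 + 1) * (((Lc : ℝ) ^ (n + 1 + 1)) ^ 2)⁻¹ := by
        rw [zpow_neg, zpow_ofNat, abs_mul, abs_neg, abs_div, abs_of_pos (pow_pos hL0 _), abs_inv, abs_of_pos hLp]
      -- the support ratio R/N = 8(3+1) is n-free
      have hRN : (4 : ℝ) * (3 + 1 : ℕ) * ((8 * (3 + 1) * Lc ^ (n + 1 + 1) : ℕ) : ℝ) / (Lc : ℝ) ^ (n + 1 + 1) + 2 * (3 + 1 : ℕ) =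
          4 * (3 + 1) * (8 * (3 + 1)) + 2 * (3 + 1) := by
        have hN0 : (Lc : ℝ) ^ (n + 1 + 1) ≠ 0 := pow_ne_zero _ hL0.ne'
        push_cast
        field_simp
        norm_num
      rw [hRN] at h2
      have hpow : (((Lc : ℝ) ^ (n + 1 + 1)) ^ 2)⁻¹ * (Lc : ℝ) ^ (n + 1) = ((Lc : ℝ) ^ 2)⁻¹ * ((Lc : ℝ)⁻¹) ^ (n + 1) := by
        have hL1 : (Lc : ℝ) ≠ 0 := hL0.ne'
        have e2 : ((Lc : ℝ) ^ (n + 1 + 1)) ^ 2 = (Lc : ℝ) ^ 2 * (Lc : ℝ) ^ (n + 1) * (Lc : ℝ) ^ (n + 1) := by ring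
        rw [e2, inv_pow, mul_inv, mul_inv, mul_assoc, mul_assoc, inv_mul_cancel₀ (pow_ne_zero _ hL1), mul_one]
      set E := Real.exp (-(κ₁ / 2) * (l1 (x' - u') + l1 (z' - u'))) with hE
      rw [abs_mul, hpre]
      calc |cVH| / (Lc : ℝ) ^ (3 + 1) * (((Lc : ℝ) ^ (n + 1 + 1)) ^ 2)⁻¹ * |_|
          ≤ |cVH| / (Lc : ℝ) ^ (3 + 1) * (((Lc : ℝ) ^ (n + 1 + 1)) ^ 2)⁻¹ *
              (2 * ((Fintype.card (Fin (3 + 1)) : ℝ) ^ 3 * A ^ 3 * Real.exp (κ₁ * (4 * (3 + 1) * (8 * (3 + 1)) + 2 * (3 + 1))) *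
                ((Lc : ℝ) ^ (n + 1) * B₂) * Zl (3 + 1) (κ₁ / 2) * E)) := mul_le_mul_of_nonneg_left h2 (by positivity)
        _ = |cVH| / (Lc : ℝ) ^ (3 + 1) * ((((Lc : ℝ) ^ (n + 1 + 1)) ^ 2)⁻¹ * (Lc : ℝ) ^ (n + 1)) * K * E := by rw [hK]; ring
        _ = c₀V * ((Lc : ℝ)⁻¹) ^ (n + 1) * E := by rw [hpow, hc₀V]; ring
    · simp only [e3OfS_inl_inr, mul_zero, abs_zero]
      exact hRHS
  · simp only [e3OfS_inr, mul_zero, abs_zero]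
    exact hRHS

end Summit.QuantumFields.BalabanUV.Beta.GAN24.S3RowV0At

end
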